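import Literature.AnabelianGeometry.EtaleTheta.Discharge.Sec1CuspInertiaEllDivisible
import Literature.AnabelianGeometry.EtaleTheta.SettingCompletion
import Literature.AnabelianGeometry.EtaleTheta.EtaleThetaClass
import Mathlib.Topology.Algebra.ClopenNhdofOne
import Mathlib.Topology.Algebra.OpenSubgroup
import HarnessLib

/-!
# [EtTh] §1: `⨅_N N·(Δ^tp_Y)^ell = 1` in `(Π^tp_X)^ell` for EVERY theta setting (the profinite completion sees
# no divisible elements) — hence, at `IsTateOrigin` + R2, the inertia of every cusp of `Y` lies in
# `Ker(Π^tp_X ↠ (Π^tp_X)^ell) = toHat⁻¹(closure [Δ_X, Δ_X])` UNCONDITIONALLY, and its `Θ`-image in `Δ_Θ`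

Mochizuki, *The étale theta function and its Frobenioid-theoretic manifestations*, Publ. RIMS **45** (2009) [EtTh],
§1, kurims PDF p. 12 «`Π_X := (Π^tp_X)^∧`», «`Δ_X` … a profinite free group on 2 generators», «the quotients
`Π^tp_X ↠ (Π^tp_X)^Θ ↠ (Π^tp_X)^ell` whose kernels are the kernels of `Δ^tp_X ↠ (Δ^tp_X)^Θ ↠ (Δ^tp_X)^ell` … induced
by `Δ_X ↠ Δ^Θ_X ↠ Δ^ell_X`», p. 13 «`(Δ^tp_Y)^ell ≅ Ẑ(1)`», «`Δ^tp_Y/Δ^tp_{Y_N} ≅ ℤ/Nℤ(1)`» (p. 16), Def. 2.1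
p. 35 «`D_x → Π^Θ_X` … maps the inertia group `I_x ⊆ D_x` isomorphically onto `Δ_Θ`»
[cite: MochizukiEtTh2009, §1 p.12]; [SemiAnbd] §6 p. 69 «`Π_{X_K} = (Π^temp_{X_K})^∧`», p. 71 «`I_x ≅ Ẑ(1)`»
[cite: MochizukiSemiAnbd2006, §6 p.71].  abc-iut cell, layer L2, seat abc-iut-w5-d051 (gen 4; NV / §1-interface
lane); PROOF-ONLY sequel of `Sec1CuspInertiaEllDivisible.lean` (p449035).

WHAT.  The root interface records `Ker(Π^tp_X ↠ (Π^tp_X)^ell) = toHat⁻¹(closure [Δ_X, Δ_X])` (`ThetaSetting.ker_toEll`)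
and that `Π_X = PiHat` is a PROFINITE completion (compact, Hausdorff, totally disconnected;
`TemperedCurve.isProfiniteCompletion_toHat`).  From these two fields ALONE — no origin clause, no `R3`, no model:

* `ThetaSetting.iInf_sup_openNormal_le` — in the profinite `Π_X`, a closed subgroup `K` satisfies
  `⨅_U (K ⊔ U) ≤ K` over the open normal subgroups `U` (Mathlib's
  `ProfiniteGrp.exist_openNormalSubgroup_sub_open_nhds_of_one` applied off the compact translate `K⁻¹x`);
* `ThetaSetting.toHat_mem_commutatorClosure_sup_of_forall_mem_ellPowersY` — if `y^ell ∈ N·(Δ^tp_Y)^ell` for EVERY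
  `N` (abc-iut-L6-d5's `Thm16Sub.ellPowersY D N` = the subgroup generated by the `N`-th powers of `(Δ^tp_Y)^ell`),
  then `toHat y ∈ closure[Δ_X,Δ_X] · U` for every open normal `U ⊆ Π_X`: with `N := |Π_X/(closure[Δ_X,Δ_X]·U)|` every
  `N`-th power dies in that finite quotient (`pow_card_eq_one'`);
* **`ThetaSetting.toEll_eq_one_of_forall_mem_ellPowersY`**, **`ThetaSetting.iInf_ellPowersY_eq_bot`** —
  `⨅_{N ≥ 1} N·(Δ^tp_Y)^ell = 1` in `(Π^tp_X)^ell` for EVERY `D : ThetaSetting p`: the typed ell-quotient has NO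
  non-trivial divisible element (as «`(Δ^tp_Y)^ell ≅ Ẑ(1)`» predicts), because it embeds into the profinite
  `Δ_X/closure[Δ_X,Δ_X]`;
* hence the SEPARATED forms of p449035 hold UNCONDITIONALLY — the hypothesis `hsep` there is a theorem:
  `ThetaSetting.ellPowersY_separated`; **`ThetaSetting.IsTateOrigin.inertia_le_ker_toEll`** /
  `.inertia_le_comap_commutator` (at `IsTateOrigin` + R2 for every `N`, the inertia `Dc ∩ Δ^tp_X` of EVERY cuspidal
  decomposition group `Dc ⊆ Π^tp_Y` lies in `Ker(Π^tp_X ↠ (Π^tp_X)^ell) = toHat⁻¹(closure [Δ_X, Δ_X])` — the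
  COMMUTATOR part, as print's `I_x = ⟨[a,b]⟩^Ẑ`), **`ThetaSetting.IsTateOrigin.map_toTheta_inertia_le_deltaTheta`**
  (its image in `(Π^tp_X)^Θ` lies in `Δ_Θ = Ker((Π^tp_X)^Θ ↠ (Π^tp_X)^ell)` — the `⊆` HALF of the cusp law C3
  «`D_x → Π^Θ_X` maps `I_x` onto `Δ_Θ`» of abc-iut-L2-t7's `ThetaSetting.CuspLaws.map_toTheta_inertia`, DERIVED from
  the Tate-module clause + the printed construction of `Y_N`; the `⊇` half is the genuine-models-only clause of
  GAP row G-L2t10-3), and the joint-origin forms `inertia_le_ker_toEll_of_origins` /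
  `map_toTheta_inertia_le_deltaTheta_of_origins` (`IsThm16Origin ∧ IsTateOrigin`), `…_of_origins_of_isCusp` for the
  representative `D_x` of a cusp with `D_x ⊆ Π^tp_Y` (parameter (P3) of `OncePuncturedData`).

WHY (NV census of the origin predicates; abc-iut-L2-lead 13:00Z v-next, NV registers abc-iut-w5-d029 / w5-d197).
p449035 showed that a joint inhabitant of `IsThm16Origin ∧ IsTateOrigin` (none in the zoo:
`SettingModel.no_joint_isThm16Origin_isTateOrigin_in_zoo`; none in the power-twist family: abc-iut-w5-d165's
`SettingModelChiTwistCuspObstruction`) must carry its cusp inertia inside `⨅_N N·(Δ^tp_Y)^ell`; this file removes the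
last proviso: that intersection is trivial in every theta setting whatsoever, so the cusp inertia of a joint origin
lies on the commutator side of `Δ_X` and under `Δ_Θ` in the theta quotient — exactly where print puts it, and exactly
where every Galois section acts through the cyclotomic character (abc-iut-w5-d187's
`exists_conj_commutator_eq_pow_mul_pow`).  PROOF-ONLY: no definition, no instance, no named fact; nothing restated.
HONEST FRAMING: interface law over the frozen root; the origin predicates are hypotheses inhabited only at models;
nothing of [EtTh]/[SemiAnbd] is asserted for genuine tempered fundamental groups; no side is taken on [IUTchIII]
Cor. 3.12; typed ≠ proved.
-/

noncomputable section

namespace Literature.AnabelianGeometry.EtaleTheta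

open Literature.AnabelianGeometry.SemiGraphs Thm16Sub
open scoped Pointwise

namespace ThetaSetting

variable {p : ℕ} [Fact p.Prime] (D : ThetaSetting p)

/-! ### 1. Profinite bookkeeping in `Π_X = PiHat` -/

/-- `Π_X` is compact ([SemiAnbd] §6 p. 69: a profinite completion). [cite: MochizukiSemiAnbd2006, §6 p.69] -/
theorem compactSpace_piHat : CompactSpace D.PiHat := D.isProfiniteCompletion_toHat.compactSpace

/-- `Π_X` is Hausdorff. [cite: MochizukiSemiAnbd2006, §6 p.69] -/
theorem t2Space_piHat : T2Space D.PiHat := D.isProfiniteCompletion_toHat.t2Space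

/-- `Π_X` is totally disconnected. [cite: MochizukiSemiAnbd2006, §6 p.69] -/
theorem totallyDisconnectedSpace_piHat : TotallyDisconnectedSpace D.PiHat :=
  D.isProfiniteCompletion_toHat.totallyDisconnectedSpace

/-- `closure [Δ_X, Δ_X]` is normal in `Π_X` (`Δ_X ⊴ Π_X`, abc-iut-L2-t7's `SettingCompletion.deltaHat_normal`).
[cite: MochizukiEtTh2009, §1 p.12] -/
theorem commutatorClosure_normal : (⁅D.DeltaHat, D.DeltaHat⁆.topologicalClosure).Normal := by
  haveI := SettingCompletion.deltaHat_normal D.toTemperedCurve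
  exact Subgroup.is_normal_topologicalClosure _

/-- **In the profinite `Π_X`, a closed subgroup is the intersection of its open-normal thickenings**:
if `x ∈ K ⊔ U` for every open normal subgroup `U` of `Π_X` then `x ∈ K` (`K` closed and normal — normality only
to read `K ⊔ U` as the product set `K·U`). [cite: MochizukiSemiAnbd2006, §6 p.69] -/
theorem mem_of_forall_mem_sup_openNormal {K : Subgroup D.PiHat} [K.Normal] (hK : IsClosed (K : Set D.PiHat))
    {x : D.PiHat} (hx : ∀ U : OpenNormalSubgroup D.PiHat, x ∈ K ⊔ U.toSubgroup) : x ∈ K := by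
  haveI := D.compactSpace_piHat
  haveI := D.t2Space_piHat
  haveI := D.totallyDisconnectedSpace_piHat
  by_contra hxK
  -- the compact translate `{k⁻¹ x | k ∈ K}` misses `1`
  have hcpt : IsCompact ((fun k : D.PiHat => k⁻¹ * x) '' (K : Set D.PiHat)) :=
    (hK.isCompact).image (by fun_prop)
  have hopen : IsOpen ((fun k : D.PiHat => k⁻¹ * x) '' (K : Set D.PiHat))ᶜ := hcpt.isClosed.isOpen_compl
  have hone : (1 : D.PiHat) ∈ ((fun k : D.PiHat => k⁻¹ * x) '' (K : Set D.PiHat))ᶜ := by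
    rintro ⟨k, hk, hk1⟩
    apply hxK
    have : x = k := by
      have h := hk1
      rw [inv_mul_eq_one] at h
      exact h.symm
    rw [this]
    exact hk
  obtain ⟨U, hU⟩ := ProfiniteGrp.exist_openNormalSubgroup_sub_open_nhds_of_one hopen hone
  -- but `x ∈ K·U`
  have hxU := hx U
  have hset : x ∈ ((K ⊔ U.toSubgroup : Subgroup D.PiHat) : Set D.PiHat) := hxU
  rw [Subgroup.normal_mul] at hset
  obtain ⟨k, hk, u, hu, hku⟩ := Set.mem_mul.mp hset
  have hu' : u = k⁻¹ * x := by rw [← hku, inv_mul_cancel_left]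
  have : k⁻¹ * x ∈ (U : Set D.PiHat) := hu' ▸ hu
  exact hU this ⟨k, hk, rfl⟩

/-! ### 2. `N`-th powers for every `N` die in `Π_X / closure[Δ_X,Δ_X]` -/

/-- **If `y^ell ∈ N·(Δ^tp_Y)^ell` for every `N`, then `toHat y ∈ closure[Δ_X,Δ_X] · U` for every open normal subgroup
`U ⊆ Π_X`.**  Unfolding `ellPowersY` (the subgroup GENERATED by the `N`-th powers of `(Δ^tp_Y)^ell`, an algebraic
closure) along the homomorphism `y ↦ y^ell`: `y ≡ w` modulo `Ker(↠ ell) = toHat⁻¹(closure[Δ_X,Δ_X])` for some `w` in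
the subgroup generated by `N`-th powers of elements of `Δ^tp_Y`; in the FINITE quotient
`Π_X/(closure[Δ_X,Δ_X]·U)` of order `N` every `N`-th power is trivial. [cite: MochizukiEtTh2009, §1 p.13] -/
theorem toHat_mem_commutatorClosure_sup_of_forall_mem_ellPowersY {y : D.PiTemp}
    (hy : ∀ N : ℕ+, toEll D y ∈ ellPowersY D N) (U : OpenNormalSubgroup D.PiHat) :
    D.toHat y ∈ ⁅D.DeltaHat, D.DeltaHat⁆.topologicalClosure ⊔ U.toSubgroup := by
  classical
  haveI := D.compactSpace_piHat
  haveI := D.commutatorClosure_normal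
  set K₂ : Subgroup D.PiHat := ⁅D.DeltaHat, D.DeltaHat⁆.topologicalClosure with hK₂
  -- the finite quotient `Q := Π_X/(K₂·U)` and its order `N`
  have hopen : IsOpen ((K₂ ⊔ U.toSubgroup : Subgroup D.PiHat) : Set D.PiHat) :=
    Subgroup.isOpen_mono le_sup_right U.isOpen
  haveI : Finite (D.PiHat ⧸ (K₂ ⊔ U.toSubgroup)) := Subgroup.quotient_finite_of_isOpen _ hopen
  haveI : Nonempty (D.PiHat ⧸ (K₂ ⊔ U.toSubgroup)) := ⟨1⟩
  set N : ℕ+ := ⟨Nat.card (D.PiHat ⧸ (K₂ ⊔ U.toSubgroup)), Nat.card_pos⟩ with hN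
  -- the composite `ρ : Π^tp_X → Π_X → Q`
  set ρ : D.PiTemp →* D.PiHat ⧸ (K₂ ⊔ U.toSubgroup) :=
    (QuotientGroup.mk' (K₂ ⊔ U.toSubgroup)).comp D.toHat.toMonoidHom with hρ
  have hρ_apply : ∀ g : D.PiTemp, ρ g = ((D.toHat g : D.PiHat) : D.PiHat ⧸ (K₂ ⊔ U.toSubgroup)) :=
    fun g => rfl
  -- `ρ` kills the `N`-th powers of `Π^tp_X`, hence the subgroup they generate
  have hpow : Subgroup.closure ((fun u : D.PiTemp => u ^ (N : ℕ)) '' (D.DtpY : Set D.PiTemp)) ≤ ρ.ker := by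
    rw [Subgroup.closure_le]
    rintro _ ⟨u, -, rfl⟩
    rw [SetLike.mem_coe, MonoidHom.mem_ker, map_pow]
    exact pow_card_eq_one'
  -- `ρ` kills `Ker(Π^tp_X ↠ (Π^tp_X)^ell) = toHat⁻¹ K₂`
  have hker : (toEll D).ker ≤ ρ.ker := by
    intro x hx
    have hx' : D.toHat.toMonoidHom x ∈ K₂ := by
      have h := hx
      rw [show (toEll D).ker = K₂.comap D.toHat.toMonoidHom from D.ker_toEll] at h
      exact h
    rw [MonoidHom.mem_ker, hρ_apply]
    exact (QuotientGroup.eq_one_iff _).mpr (Subgroup.mem_sup_left hx')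
  -- unfold `ellPowersY D N` along `toEll`
  have himage : ((fun e : D.GtpEll => e ^ (N : ℕ)) '' (D.DtpY.map (toEll D) : Set D.GtpEll)) =
      toEll D '' ((fun u : D.PiTemp => u ^ (N : ℕ)) '' (D.DtpY : Set D.PiTemp)) := by
    ext e
    constructor
    · rintro ⟨_, ⟨u, hu, rfl⟩, rfl⟩
      exact ⟨u ^ (N : ℕ), ⟨u, hu, rfl⟩, map_pow _ _ _⟩
    · rintro ⟨_, ⟨u, hu, rfl⟩, rfl⟩
      exact ⟨toEll D u, ⟨u, hu, rfl⟩, (map_pow _ _ _).symm⟩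
  have hmap : ellPowersY D N =
      (Subgroup.closure ((fun u : D.PiTemp => u ^ (N : ℕ)) '' (D.DtpY : Set D.PiTemp))).map (toEll D) := by
    rw [ellPowersY, himage, MonoidHom.map_closure]
  obtain ⟨w, hw, hwy⟩ := (hmap ▸ hy N : toEll D y ∈
    (Subgroup.closure ((fun u : D.PiTemp => u ^ (N : ℕ)) '' (D.DtpY : Set D.PiTemp))).map (toEll D))
  -- `y = (y w⁻¹) · w` with `y w⁻¹ ∈ Ker(↠ ell)` and `w` in the span of `N`-th powers
  have hyw : y * w⁻¹ ∈ (toEll D).ker := by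
    rw [MonoidHom.mem_ker, map_mul, map_inv, ← hwy, mul_inv_cancel]
  have h1 : ρ (y * w⁻¹) = 1 := hker hyw
  have h2 : ρ w = 1 := hpow hw
  have hρy : ρ y = 1 := by
    have : y = y * w⁻¹ * w := by rw [inv_mul_cancel_right]
    rw [this, map_mul, h1, h2, one_mul]
  rw [hρ_apply] at hρy
  exact (QuotientGroup.eq_one_iff _).mp hρy

/-- **If `y^ell ∈ N·(Δ^tp_Y)^ell` for every `N`, then `toHat y ∈ closure[Δ_X,Δ_X]`** (`Π_X` profinite: §1).
[cite: MochizukiEtTh2009, §1 p.12] -/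
theorem toHat_mem_commutatorClosure_of_forall_mem_ellPowersY {y : D.PiTemp}
    (hy : ∀ N : ℕ+, toEll D y ∈ ellPowersY D N) :
    D.toHat y ∈ ⁅D.DeltaHat, D.DeltaHat⁆.topologicalClosure := by
  haveI := D.commutatorClosure_normal
  exact D.mem_of_forall_mem_sup_openNormal (Subgroup.isClosed_topologicalClosure _)
    (D.toHat_mem_commutatorClosure_sup_of_forall_mem_ellPowersY hy)

/-- **`y^ell ∈ N·(Δ^tp_Y)^ell` for every `N` ⇒ `y^ell = 1`** (root field `ker_toEll`).
[cite: MochizukiEtTh2009, §1 p.12] -/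
theorem toEll_eq_one_of_forall_mem_ellPowersY {y : D.PiTemp} (hy : ∀ N : ℕ+, toEll D y ∈ ellPowersY D N) :
    toEll D y = 1 := by
  have h : y ∈ (D.thetaToEll.comp D.toTheta).ker := by
    rw [D.ker_toEll]
    exact D.toHat_mem_commutatorClosure_of_forall_mem_ellPowersY hy
  exact h

/-- **`⨅_{N ≥ 1} N·(Δ^tp_Y)^ell = 1` in `(Π^tp_X)^ell`, for EVERY theta setting** — the typed ell-quotient has no
non-trivial divisible element («`(Δ^tp_Y)^ell ≅ Ẑ(1)`», p. 13). [cite: MochizukiEtTh2009, §1 p.13] -/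
theorem iInf_ellPowersY_eq_bot : (⨅ N : ℕ+, ellPowersY D N) = ⊥ := by
  refine (Subgroup.eq_bot_iff_forall _).mpr fun e he => ?_
  obtain ⟨y, rfl⟩ : ∃ y : D.PiTemp, toEll D y = e :=
    (D.thetaToEll_surjective.comp D.toTheta_surjective) e
  exact D.toEll_eq_one_of_forall_mem_ellPowersY fun N => (Subgroup.mem_iInf.mp he) N

/-- The separation hypothesis `hsep` of `Sec1CuspInertiaEllDivisible` is a THEOREM for every theta setting.
[cite: MochizukiEtTh2009, §1 p.13] -/
theorem ellPowersY_separated :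
    ∀ e ∈ D.DtpY.map (toEll D), (∀ N : ℕ+, e ∈ ellPowersY D N) → e = 1 := by
  rintro _ ⟨y, -, rfl⟩ hy
  exact D.toEll_eq_one_of_forall_mem_ellPowersY hy

/-! ### 3. The cusp inertia of a joint origin lies on the commutator side, under `Δ_Θ` -/

/-- **`IsTateOrigin` + R2 for every `N` ⇒ the inertia of every cusp of `Y` lies in `Ker(Π^tp_X ↠ (Π^tp_X)^ell)`**
(unconditional form of p449035's `inertia_le_ker_toEll_of_separated`). [cite: MochizukiEtTh2009, §1 p.13] -/
theorem IsTateOrigin.inertia_le_ker_toEll {D : ThetaSetting p} (hT : D.IsTateOrigin)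
    (hR2 : ∀ N : ℕ+, GtpYNFromCusp D N) {Dc : Subgroup D.PiTemp} (hDc : D.IsCuspidalDecompositionGroup Dc)
    (hDcY : Dc ≤ D.GtpY) : Dc ⊓ D.DeltaTemp ≤ (toEll D).ker :=
  hT.inertia_le_ker_toEll_of_separated hR2 D.ellPowersY_separated hDc hDcY

/-- **… i.e. in `toHat⁻¹(closure [Δ_X, Δ_X])`** — the commutator side of `Δ_X`, as print's `I_x = ⟨[a,b]⟩^Ẑ`.
[cite: MochizukiEtTh2009, §1 p.12] -/
theorem IsTateOrigin.inertia_le_comap_commutator {D : ThetaSetting p} (hT : D.IsTateOrigin)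
    (hR2 : ∀ N : ℕ+, GtpYNFromCusp D N) {Dc : Subgroup D.PiTemp} (hDc : D.IsCuspidalDecompositionGroup Dc)
    (hDcY : Dc ≤ D.GtpY) :
    Dc ⊓ D.DeltaTemp ≤ (⁅D.DeltaHat, D.DeltaHat⁆.topologicalClosure).comap D.toHat.toMonoidHom :=
  hT.inertia_le_comap_commutator_of_separated hR2 D.ellPowersY_separated hDc hDcY

/-- **`IsTateOrigin` + R2 for every `N` ⇒ the `Θ`-image of the inertia of every cusp of `Y` lies in `Δ_Θ`** — the `⊆`
half of «`D_x → Π^Θ_X` maps `I_x` isomorphically onto `Δ_Θ`» (Def. 2.1 p. 35; abc-iut-L2-t7's cusp law C3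
`CuspLaws.map_toTheta_inertia`), derived from the Tate-module clause and the printed construction of `Y_N`.
[cite: MochizukiEtTh2009, Def 2.1 p.35] -/
theorem IsTateOrigin.map_toTheta_inertia_le_deltaTheta {D : ThetaSetting p} (hT : D.IsTateOrigin)
    (hR2 : ∀ N : ℕ+, GtpYNFromCusp D N) {Dc : Subgroup D.PiTemp} (hDc : D.IsCuspidalDecompositionGroup Dc)
    (hDcY : Dc ≤ D.GtpY) : (Dc ⊓ D.DeltaTemp).map D.toTheta ≤ D.DeltaTheta := by
  rintro _ ⟨g, hg, rfl⟩
  have h : g ∈ (toEll D).ker := hT.inertia_le_ker_toEll hR2 hDc hDcY hg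
  exact h

/-- **At a JOINT origin (`IsThm16Origin ∧ IsTateOrigin`) the inertia of every cusp of `Y` lies in
`Ker(Π^tp_X ↠ (Π^tp_X)^ell)`.** [cite: MochizukiEtTh2009, §1 p.13] -/
theorem inertia_le_ker_toEll_of_origins {D : ThetaSetting p} (h16 : D.IsThm16Origin) (hT : D.IsTateOrigin)
    {Dc : Subgroup D.PiTemp} (hDc : D.IsCuspidalDecompositionGroup Dc) (hDcY : Dc ≤ D.GtpY) :
    Dc ⊓ D.DeltaTemp ≤ (toEll D).ker :=
  hT.inertia_le_ker_toEll h16.gtpYN_fromCusp hDc hDcY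

/-- **At a JOINT origin the inertia of every cusp of `Y` lies in `toHat⁻¹(closure [Δ_X, Δ_X])`.**
[cite: MochizukiEtTh2009, §1 p.12] -/
theorem inertia_le_comap_commutator_of_origins {D : ThetaSetting p} (h16 : D.IsThm16Origin)
    (hT : D.IsTateOrigin) {Dc : Subgroup D.PiTemp} (hDc : D.IsCuspidalDecompositionGroup Dc)
    (hDcY : Dc ≤ D.GtpY) :
    Dc ⊓ D.DeltaTemp ≤ (⁅D.DeltaHat, D.DeltaHat⁆.topologicalClosure).comap D.toHat.toMonoidHom :=
  hT.inertia_le_comap_commutator h16.gtpYN_fromCusp hDc hDcY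

/-- **At a JOINT origin the `Θ`-image of the inertia of every cusp of `Y` lies in `Δ_Θ`** (`⊆` half of the cusp law
C3). [cite: MochizukiEtTh2009, Def 2.1 p.35] -/
theorem map_toTheta_inertia_le_deltaTheta_of_origins {D : ThetaSetting p} (h16 : D.IsThm16Origin)
    (hT : D.IsTateOrigin) {Dc : Subgroup D.PiTemp} (hDc : D.IsCuspidalDecompositionGroup Dc)
    (hDcY : Dc ≤ D.GtpY) : (Dc ⊓ D.DeltaTemp).map D.toTheta ≤ D.DeltaTheta :=
  hT.map_toTheta_inertia_le_deltaTheta h16.gtpYN_fromCusp hDc hDcY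

/-- **The representative form**: at a joint origin, for a cusp `x` of `X^log` whose decomposition group `D_x` lies in
`Π^tp_Y` («decomposition groups of cusps lie in `Π^tp_Y`», p. 13 — parameter (P3) of abc-iut-L2-t7's
`OncePuncturedData`), `toTheta(I_x) ⊆ Δ_Θ` for the [SemiAnbd] §6 inertia `I_x = D_x ∩ Δ^tp_X`.
[cite: MochizukiEtTh2009, Def 2.1 p.35] -/
theorem map_toTheta_inertia_le_deltaTheta_of_origins_of_isCusp {D : ThetaSetting p} (h16 : D.IsThm16Origin)
    (hT : D.IsTateOrigin) {x : D.Pt} (hx : D.IsCusp x) (hP3 : D.decomp x ≤ D.GtpY) :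
    (D.inertia x).map D.toTheta ≤ D.DeltaTheta :=
  D.map_toTheta_inertia_le_deltaTheta_of_origins h16 hT ⟨x, hx, 1, (one_smul _ _).symm⟩ hP3

/-- The same in the `ell`-kernel form: `I_x ⊆ Ker(Π^tp_X ↠ (Π^tp_X)^ell)` for a cusp `x` with `D_x ⊆ Π^tp_Y` at a joint
origin. [cite: MochizukiEtTh2009, §1 p.13] -/
theorem inertia_le_ker_toEll_of_origins_of_isCusp {D : ThetaSetting p} (h16 : D.IsThm16Origin)
    (hT : D.IsTateOrigin) {x : D.Pt} (hx : D.IsCusp x) (hP3 : D.decomp x ≤ D.GtpY) :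
    D.inertia x ≤ (toEll D).ker :=
  D.inertia_le_ker_toEll_of_origins h16 hT ⟨x, hx, 1, (one_smul _ _).symm⟩ hP3

end ThetaSetting

end Literature.AnabelianGeometry.EtaleTheta

end
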